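import Summits.Ventures.HodgeRepro2.T5BergmanCoefficient

/-!
# Unitarity of the weighted Bergman model

The weight-`k` action `(π_k(g) f)(z) = j(g⁻¹, z)^{-k} f(g⁻¹ · z)` of `SU(1,1)` preserves the
Bergman pairing `⟨f₁, f₂⟩_k = ∫_𝔻 f₁ f̄₂ (1 - |z|²)^{k-2} dA` (`k ≥ 2`):

  `⟨π_k(g) f₁, π_k(g) f₂⟩_k = ⟨f₁, f₂⟩_k`   for ALL functions `f₁ f₂ : ℂ → ℂ`.

Proof: with `φ = g⁻¹·` and `j = j(g⁻¹, ·)`, the integrand is `|j|^{-2k} (f₁ f̄₂)(φ z) (1 - |z|²)^{k-2}`;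
since `1 - |φ z|² = (1 - |z|²)/|j(z)|²` and the real Jacobian of `φ` is `|j|^{-4}`
(`T5PoincareMeasure.abs_det_mul_dens`), this is `|det Dφ(z)| · G(φ z)` for
`G(w) = (f₁ f̄₂)(w) (1 - |w|²)^{k-2}`, and the change of variables `z ↦ φ z` (a bijection of the
disc, Mathlib's `integral_image_eq_integral_abs_det_fderiv_smul`) gives `∫_𝔻 G`.  No integrability
hypothesis is needed (the change-of-variables formula holds for every integrand).

Together with `T5BergmanCoefficient` (the representation property and the lowest-weight
coefficient) this makes the explicit model a unitary representation for the pairing — the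
«`π₃⁺` unitary, `f` the lowest-weight vector» of S4 l. 82 in the disc picture; what stays printed
is the identification of this model with Rühl's `π₃⁺`.

Blind lane: Mathlib + the HodgeRepro2 prefix only; no sorry; axioms ⊆ {propext, Classical.choice,
Quot.sound}.
-/

namespace Summit.Ventures.HodgeRepro2.T5BergmanUnitary

open MeasureTheory MeasureTheory.Measure Metric
open T5PoincareDensity T5PoincareInvariance T5PoincareMeasure T5SU11Unimodular T5SU11Fibration
  T5BergmanCoefficient
open scoped Real

/-! ### The Bochner change of variables for the Möbius map with the Poincaré density -/

/-- **Change of variables on the disc** (Bochner form): `∫_𝔻 dens · G ∘ (g·) = ∫_𝔻 dens · G` for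
every `G : ℂ → ℂ` and `g = su11 a b ∈ SU(1,1)`. -/
theorem integral_ball_comp_mobius (a b : ℂ) (h : Complex.normSq a - Complex.normSq b = 1)
    (G : ℂ → ℂ) :
    ∫ z in ball (0 : ℂ) 1, (dens z : ℂ) * G (mobius (su11 a b) z) =
      ∫ z in ball (0 : ℂ) 1, (dens z : ℂ) * G z := by
  have key := integral_image_eq_integral_abs_det_fderiv_smul volume measurableSet_ball
    (fun z hz => hasFDerivWithinAt_mobius h hz) (mobius_injOn_ball a b h)
    (fun w => (dens w : ℂ) * G w)
  rw [mobius_image_ball a b h] at key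
  rw [key]
  apply setIntegral_congr_fun measurableSet_ball
  intro z hz
  dsimp only
  rw [Complex.real_smul, ← mul_assoc, ← Complex.ofReal_mul, abs_det_mul_dens h hz]

/-! ### The pointwise identity -/

/-- `j⁻ᵏ · conj (j⁻ᵏ) = |j|^{-2k}`. -/
lemma inv_pow_mul_conj_inv_pow (j : ℂ) (n : ℕ) :
    j⁻¹ ^ n * (starRingEnd ℂ) (j⁻¹ ^ n) = ((Complex.normSq j : ℝ) : ℂ)⁻¹ ^ n := by
  rw [map_pow, map_inv₀, ← mul_pow, ← mul_inv, Complex.mul_conj]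

/-- The integrand of `⟨π_k(g) f₁, π_k(g) f₂⟩_k` at `z ∈ 𝔻` equals `dens z · G(g⁻¹ · z)` with
`G(w) = f₁(w) f̄₂(w) (1 - |w|²)^{k-2} (1 - |w|²)²`. -/
lemma integrand_eq (k : ℕ) (hk : 2 ≤ k) (a b : ℂ) (h : Complex.normSq a - Complex.normSq b = 1)
    (f₁ f₂ : ℂ → ℂ) {z : ℂ} (hz : z ∈ ball (0 : ℂ) 1) :
    (denom (su11 a b) z)⁻¹ ^ k * f₁ (mobius (su11 a b) z) *
        (starRingEnd ℂ) ((denom (su11 a b) z)⁻¹ ^ k * f₂ (mobius (su11 a b) z)) *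
        (((1 - ‖z‖ ^ 2) ^ (k - 2) : ℝ) : ℂ) =
      (dens z : ℂ) * (f₁ (mobius (su11 a b) z) * (starRingEnd ℂ) (f₂ (mobius (su11 a b) z)) *
        (((1 - ‖mobius (su11 a b) z‖ ^ 2) ^ (k - 2) : ℝ) : ℂ) *
        (((1 - ‖mobius (su11 a b) z‖ ^ 2) ^ 2 : ℝ) : ℂ)) := by
  obtain ⟨m, rfl⟩ := Nat.exists_eq_add_of_le' hk
  have hz' : Complex.normSq z < 1 := (mem_ball_iff_normSq z).mp hz
  have hj : denom (su11 a b) z ≠ 0 := by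
    rw [denom_su11]
    exact denom_ne_zero h hz'
  set j := denom (su11 a b) z with hjdef
  set N : ℝ := Complex.normSq j with hN
  have hN0 : N ≠ 0 := by
    rw [hN]
    exact Complex.normSq_pos.mpr hj |>.ne'
  have hphi : 1 - ‖mobius (su11 a b) z‖ ^ 2 = (1 - ‖z‖ ^ 2) / N := by
    rw [← Complex.normSq_eq_norm_sq, ← Complex.normSq_eq_norm_sq, one_sub_normSq_mobius h hz', hN,
      hjdef, denom_su11]
  have hz1 : (1 - ‖z‖ ^ 2) ≠ 0 := by
    rw [← Complex.normSq_eq_norm_sq]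
    linarith
  have hdens : dens z = 1 / (1 - ‖z‖ ^ 2) ^ 2 := by
    rw [dens, Complex.normSq_eq_norm_sq]
  rw [hphi, hdens, show m + 2 - 2 = m by omega]
  -- the conjugate factor
  have e1 : j⁻¹ ^ (m + 2) * f₁ (mobius (su11 a b) z) *
      (starRingEnd ℂ) (j⁻¹ ^ (m + 2) * f₂ (mobius (su11 a b) z)) =
      ((N : ℝ) : ℂ)⁻¹ ^ (m + 2) * (f₁ (mobius (su11 a b) z) *
        (starRingEnd ℂ) (f₂ (mobius (su11 a b) z))) := by
    rw [map_mul, ← inv_pow_mul_conj_inv_pow j (m + 2)]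
    ring
  rw [e1]
  have hz1c : (1 : ℂ) - (‖z‖ : ℂ) ^ 2 ≠ 0 := by exact_mod_cast hz1
  have hNc : (N : ℂ) ≠ 0 := by exact_mod_cast hN0
  push_cast
  rw [inv_pow, div_pow, div_pow]
  field_simp
  ring

/-! ### Unitarity -/

/-- **The action is unitary for the Bergman pairing**: `⟨π_k(g) f₁, π_k(g) f₂⟩_k = ⟨f₁, f₂⟩_k` for
every `g ∈ SU(1,1)`, every `k ≥ 2` and ALL `f₁ f₂ : ℂ → ℂ`. -/
theorem pairing_act_act (k : ℕ) (hk : 2 ≤ k) (g : SU11) (f₁ f₂ : ℂ → ℂ) :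
    pairing k (act k g f₁) (act k g f₂) = pairing k f₁ f₂ := by
  have hab : Complex.normSq ((starRingEnd ℂ) (mat g 0 0)) - Complex.normSq (-(mat g 0 1)) = 1 := by
    rw [Complex.normSq_conj, Complex.normSq_neg]
    exact normSq_sub_normSq g
  unfold pairing act
  simp only [mat_inv]
  rw [setIntegral_congr_fun measurableSet_ball
    (fun z hz => integrand_eq k hk _ _ hab f₁ f₂ hz)]
  have key := integral_ball_comp_mobius _ _ hab (fun w => f₁ w * (starRingEnd ℂ) (f₂ w) *
    (((1 - ‖w‖ ^ 2) ^ (k - 2) : ℝ) : ℂ) * (((1 - ‖w‖ ^ 2) ^ 2 : ℝ) : ℂ))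
  rw [key]
  apply setIntegral_congr_fun measurableSet_ball
  intro z hz
  dsimp only
  have hz1 : (1 - ‖z‖ ^ 2) ≠ 0 := by
    rw [← Complex.normSq_eq_norm_sq]
    linarith [(mem_ball_iff_normSq z).mp hz]
  have hdens : dens z = 1 / (1 - ‖z‖ ^ 2) ^ 2 := by
    rw [dens, Complex.normSq_eq_norm_sq]
  have hz1c : (1 : ℂ) - (‖z‖ : ℂ) ^ 2 ≠ 0 := by exact_mod_cast hz1
  rw [hdens]
  push_cast
  field_simp

/-- The pairing is `G`-invariant in the first variable against the lowest-weight vector: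
`⟨π_k(g) f, π_k(g) 1⟩_k = ⟨f, 1⟩_k`. -/
theorem pairing_act_act_lowest (k : ℕ) (hk : 2 ≤ k) (g : SU11) (f : ℂ → ℂ) :
    pairing k (act k g f) (act k g lowest) = pairing k f lowest :=
  pairing_act_act k hk g f lowest

/-! ### Consequences: the pairing is sesquilinear and only sees the disc -/

/-- Two functions agreeing on the disc have the same pairings. -/
theorem pairing_congr {k : ℕ} {f₁ f₁' f₂ f₂' : ℂ → ℂ} (h₁ : ∀ z ∈ ball (0 : ℂ) 1, f₁ z = f₁' z)
    (h₂ : ∀ z ∈ ball (0 : ℂ) 1, f₂ z = f₂' z) : pairing k f₁ f₂ = pairing k f₁' f₂' := by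
  unfold pairing
  apply setIntegral_congr_fun measurableSet_ball
  intro z hz
  simp only [h₁ z hz, h₂ z hz]

/-- `⟨c • f₁, f₂⟩_k = c ⟨f₁, f₂⟩_k`. -/
theorem pairing_smul_left (k : ℕ) (c : ℂ) (f₁ f₂ : ℂ → ℂ) :
    pairing k (fun z => c * f₁ z) f₂ = c * pairing k f₁ f₂ := by
  unfold pairing
  rw [← integral_const_mul]
  congr 1
  ext z
  ring

/-- `⟨f₁, c • f₂⟩_k = c̄ ⟨f₁, f₂⟩_k`. -/
theorem pairing_smul_right (k : ℕ) (c : ℂ) (f₁ f₂ : ℂ → ℂ) :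
    pairing k f₁ (fun z => c * f₂ z) = (starRingEnd ℂ) c * pairing k f₁ f₂ := by
  unfold pairing
  rw [← integral_const_mul]
  congr 1
  ext z
  rw [map_mul]
  ring

/-- The representation property inside the pairing: `⟨π_k(gh) f₁, f₂⟩_k = ⟨π_k(g) π_k(h) f₁, f₂⟩_k`. -/
theorem pairing_act_mul (k : ℕ) (g h : SU11) (f₁ f₂ : ℂ → ℂ) :
    pairing k (act k (g * h) f₁) f₂ = pairing k (act k g (act k h f₁)) f₂ :=
  pairing_congr (fun _ hz => act_mul k g h f₁ hz) (fun _ _ => rfl)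

/-- **Unitarity in the form `⟨π_k(g) f₁, f₂⟩_k = ⟨f₁, π_k(g⁻¹) f₂⟩_k`** (`k ≥ 2`). -/
theorem pairing_act_left (k : ℕ) (hk : 2 ≤ k) (g : SU11) (f₁ f₂ : ℂ → ℂ) :
    pairing k (act k g f₁) f₂ = pairing k f₁ (act k g⁻¹ f₂) := by
  have h1 : pairing k (act k g f₁) f₂ = pairing k (act k g f₁) (act k g (act k g⁻¹ f₂)) := by
    apply pairing_congr (fun _ _ => rfl)
    intro _ hz
    rw [← act_mul k g g⁻¹ f₂ hz, mul_inv_cancel, act_one]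
  rw [h1, pairing_act_act k hk g]

end Summit.Ventures.HodgeRepro2.T5BergmanUnitary
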